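import Mathlib
import HarnessLib
import Summits.HubbardSuperconductivity.HubbardSuperconductivity.Theorems.KLProgrammeC4aRadialRowsTwoThree
import Summits.HubbardSuperconductivity.HubbardSuperconductivity.Theorems.KLProgrammeC4aBellRigidBoundsOne

/-!
# Route `KLProgramme` — crux C4a, (L3) for the pp and ph-exchange classes against the HONEST majorant of the above-scale bubble —
# ONE inverse power of the distance, ORDER-DEPENDENT sizes `Cb_k` — with every geometric input discharged

Cell `gate-hubbard-kl`, lane hubbard-kl-c4a-1 (g5); helper for stub (C) `stub_twoLeg_curvature` of the engine-flow child `KLRegimeEngineV17F2`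
(stmt-HubbardSuperconductivity-20437); memo HOME/hubbard-kl-c4a-1/C4A-PLAN.md §22.9.  `…C4aPairJetsL1Discharged` assumed `‖DᵏB(p)‖ ≤ Cb·max(c′‖p‖,Λ)^{−k}`; for the
bubble ABOVE scale `Λ` the honest shape is `‖DᵏB(p)‖ ≤ Cb_k·max(c′‖p‖,Λ)^{−1}` (`Cb_k ≍ U²Λ^{1−k}`: derivatives on the scale cutoffs cost `Λ^{−1}` each, transversality
of the two Fermi curves gains exactly one power of the distance — Salmhofer 1999 §4.5 Lemma 4.10 / Cor. 4.11).  This file is the corresponding assembly: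
one rigidity factor cancels the inverse power (`…C4aBellRigidBoundsOne`), the other path-jet factors are bounded by `y = L·(r + π)`, all radial rows are the tree's
(`…C4aRadialRowOne`, `…C4aRadialRowsTwoThree`), the loop angle is reduced to `[0, 2π)` by periodicity.

* `ppJetDominatorOne` (def: `0 ↦ 2Cb0`, `1 ↦ 2Cb₁x`, `2 ↦ 2(Cb₂xy + Cb₁x)`, `3 ↦ 2(Cb₃xy² + 3Cb₂xy + Cb₁x)`, `4 ↦ 2(Cb₄xy³ + 6Cb₃xy² + 7Cb₂xy + (Cb₁/Λ)·D4)`);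
* **`coMovingJetsL1_pairSum_of_inversePowerOne`** (`V(k,q) = B(k+q)`), **`coMovingJetsL1_pairDiff_of_inversePowerOne`** (`V(k,q) = B(k−q)`): hypotheses = frame sizes +
  `B ∈ C⁴`, `‖B‖ ≤ Cb0`, `‖DᵏB(p)‖ ≤ Cb_k·(max(c′‖p‖, Λ))⁻¹` (`1 ≤ k ≤ 4`, `0 ≤ Cb_k`, `0 < c′, Λ`); conclusion `CoMovingJetsL1 4 (const ppJetDominatorOne …) r μ K V` —
  the `ϑ`-integrals of the dominators are `2π·` constants whose `n`-dependence is EXACTLY that of the `Cb_k` (`U²Λ_n^{1−k}`: the graded law of the two-leg jets).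

Composition only; nothing about the Hubbard model's sizes; nothing asserts superconductivity.
References: Salmhofer 1999 §4.5.2 Lemma 4.10, Cor. 4.11 [cite: Salmhofer1999]; FST II CPAM 51 (1998) §3; BGM 2006 §2.4 (2.36)–(2.41) [cite: BenfattoGiulianiMastropietro2006].
-/

noncomputable section

namespace Summit.HubbardSuperconductivity.HubbardSuperconductivity.Theorems.C4a

set_option linter.dupNamespace false -- summit = problem name (single-conjunct summit), D-0017

open Real Set MeasureTheory Finset
open scoped ContDiff
open Literature.MathematicalPhysics.QuantumLattice Literature.MathematicalPhysics.QuantumLattice.BandSectorCounting Literature.Probability.LatticeModels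
open Summit.HubbardSuperconductivity.HubbardSuperconductivity.Theorems.KLRegimeSplit
open Summit.HubbardSuperconductivity.HubbardSuperconductivity.Theorems.DispersionFlow
open Summit.HubbardSuperconductivity.HubbardSuperconductivity.Theorems.PerturbedFermiCurve

/-- **The constant jet dominators against the honest (one-inverse-power, order-dependent) bubble majorant.** -/
def ppJetDominatorOne (Cb : ℕ → ℝ) (Cb0 x y Λ D4 : ℝ) : ℕ → ℝ
  | 0 => 2 * Cb0
  | 1 => 2 * (Cb 1 * x)
  | 2 => 2 * (Cb 2 * x * y + Cb 1 * x)
  | 3 => 2 * (Cb 3 * x * y ^ 2 + 3 * (Cb 2 * x * y) + Cb 1 * x)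
  | 4 => 2 * (Cb 4 * x * y ^ 3 + 6 * (Cb 3 * x * y ^ 2) + 7 * (Cb 2 * x * y) + Cb 1 / Λ * D4)
  | _ => 0

section Sizes

variable {K : TrigPolyC4v} {A : ℝ} (hA : ∀ p : Momentum, ∀ j ≤ 2, ‖iteratedFDeriv ℝ j (frameShift K) p‖ ≤ A) (hA20 : A ≤ 1 / 20)
  (hd : klCurveD ≤ (bandBounds (show (-4 : ℝ) < -1.1 by norm_num) (show (-1.1 : ℝ) ≤ -0.1 by norm_num)
    (show (-0.1 : ℝ) < 0 by norm_num)).Dtmin - 2 * A)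
  {μ r : ℝ} (hr : 0 < r) (hlo : (-1.1 : ℝ) < μ - r - A) (hhi : μ + r + A < -0.1)
  {A₃ A₄ : ℝ} (hA₃ : ∀ p : Momentum, ‖iteratedFDeriv ℝ 3 (frameShift K) p‖ ≤ A₃)
  (hA₄ : ∀ p : Momentum, ‖iteratedFDeriv ℝ 4 (frameShift K) p‖ ≤ A₄)
include hA hA20 hd hr hlo hhi hA₃ hA₄

/-- **(L3) FOR THE PARTICLE–PARTICLE CLASS, ASSEMBLED.**  For `B : Momentum → ℂ` of class `C⁴` with `‖B(p)‖ ≤ Cb0` and the INVERSE-POWER majorant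
`‖DᵏB(p)‖ ≤ Cb·(max(c′‖p‖, Λ)^k)⁻¹` (`1 ≤ k ≤ 4`; `0 ≤ Cb`, `0 < c′`, `0 < Λ`), and the chart's radial rows of orders 2 and 3 (`0 ≤ Lrad₂`):
`CoMovingJetsL1 4 (fun i _ => ppJetDominator Cb Cb0 x Λ (2·msD A₃ A₄ 4) i) r μ K (fun k q => B (k + q))` with
`x = max(max(radialRowOneConst A (Dt_min−2A), msD A₃ A₄ 2), max(max(Lrad₂, msD A₃ A₄ 3), max(Lrad₃, msD A₃ A₄ 4))) / (c′·pairSumLowerConst r)`.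
[cite: BenfattoGiulianiMastropietro2006, §2.4 (2.36)–(2.41)] -/
theorem coMovingJetsL1_pairSum_of_inversePowerOne {Bf : Momentum → ℂ} (hB : ContDiff ℝ 4 Bf) {Cb : ℕ → ℝ} {Cb0 c' Λ : ℝ} (hCb : ∀ k, 0 ≤ Cb k)
    (hc' : 0 < c') (hΛ : 0 < Λ)
    (hBk : ∀ p : Momentum, ∀ k, 1 ≤ k → k ≤ 4 → ‖iteratedFDeriv ℝ k Bf p‖ ≤ Cb k * (max (c' * ‖p‖) Λ)⁻¹)
    (hB0 : ∀ p : Momentum, ‖Bf p‖ ≤ Cb0) :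
    CoMovingJetsL1 4
      (fun i _ => ppJetDominatorOne Cb Cb0
        (max (max (radialRowOneConst A ((bandBounds (show (-4 : ℝ) < -1.1 by norm_num) (show (-1.1 : ℝ) ≤ -0.1 by norm_num)
            (show (-0.1 : ℝ) < 0 by norm_num)).Dtmin - 2 * A)) (msD A₃ A₄ 2)) (max (max (uRowTwoConst A A₃ ((bandBounds (show (-4 : ℝ) < -1.1 by norm_num) (show (-1.1 : ℝ) ≤ -0.1 by norm_num)
            (show (-0.1 : ℝ) < 0 by norm_num)).Dtmin - 2 * A) + 1 / ((bandBounds (show (-4 : ℝ) < -1.1 by norm_num) (show (-1.1 : ℝ) ≤ -0.1 by norm_num)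
            (show (-0.1 : ℝ) < 0 by norm_num)).Dtmin - 2 * A) + 2 * (radialRowOneConst A ((bandBounds (show (-4 : ℝ) < -1.1 by norm_num) (show (-1.1 : ℝ) ≤ -0.1 by norm_num)
            (show (-0.1 : ℝ) < 0 by norm_num)).Dtmin - 2 * A) - 1 / ((bandBounds (show (-4 : ℝ) < -1.1 by norm_num) (show (-1.1 : ℝ) ≤ -0.1 by norm_num)
            (show (-0.1 : ℝ) < 0 by norm_num)).Dtmin - 2 * A))) (msD A₃ A₄ 3)) (max (uRowThreeConst A A₃ A₄ ((bandBounds (show (-4 : ℝ) < -1.1 by norm_num) (show (-1.1 : ℝ) ≤ -0.1 by norm_num)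
            (show (-0.1 : ℝ) < 0 by norm_num)).Dtmin - 2 * A) + 3 * (radialRowOneConst A ((bandBounds (show (-4 : ℝ) < -1.1 by norm_num) (show (-1.1 : ℝ) ≤ -0.1 by norm_num)
            (show (-0.1 : ℝ) < 0 by norm_num)).Dtmin - 2 * A) - 1 / ((bandBounds (show (-4 : ℝ) < -1.1 by norm_num) (show (-1.1 : ℝ) ≤ -0.1 by norm_num)
            (show (-0.1 : ℝ) < 0 by norm_num)).Dtmin - 2 * A)) + 3 * uRowTwoConst A A₃ ((bandBounds (show (-4 : ℝ) < -1.1 by norm_num) (show (-1.1 : ℝ) ≤ -0.1 by norm_num)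
            (show (-0.1 : ℝ) < 0 by norm_num)).Dtmin - 2 * A) + 1 / ((bandBounds (show (-4 : ℝ) < -1.1 by norm_num) (show (-1.1 : ℝ) ≤ -0.1 by norm_num)
            (show (-0.1 : ℝ) < 0 by norm_num)).Dtmin - 2 * A)) (msD A₃ A₄ 4))) /
          (c' * pairSumLowerConst r))
        (max (max (radialRowOneConst A ((bandBounds (show (-4 : ℝ) < -1.1 by norm_num) (show (-1.1 : ℝ) ≤ -0.1 by norm_num)
            (show (-0.1 : ℝ) < 0 by norm_num)).Dtmin - 2 * A)) (msD A₃ A₄ 2)) (max (max (uRowTwoConst A A₃ ((bandBounds (show (-4 : ℝ) < -1.1 by norm_num) (show (-1.1 : ℝ) ≤ -0.1 by norm_num)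
            (show (-0.1 : ℝ) < 0 by norm_num)).Dtmin - 2 * A) + 1 / ((bandBounds (show (-4 : ℝ) < -1.1 by norm_num) (show (-1.1 : ℝ) ≤ -0.1 by norm_num)
            (show (-0.1 : ℝ) < 0 by norm_num)).Dtmin - 2 * A) + 2 * (radialRowOneConst A ((bandBounds (show (-4 : ℝ) < -1.1 by norm_num) (show (-1.1 : ℝ) ≤ -0.1 by norm_num)
            (show (-0.1 : ℝ) < 0 by norm_num)).Dtmin - 2 * A) - 1 / ((bandBounds (show (-4 : ℝ) < -1.1 by norm_num) (show (-1.1 : ℝ) ≤ -0.1 by norm_num)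
            (show (-0.1 : ℝ) < 0 by norm_num)).Dtmin - 2 * A))) (msD A₃ A₄ 3)) (max (uRowThreeConst A A₃ A₄ ((bandBounds (show (-4 : ℝ) < -1.1 by norm_num) (show (-1.1 : ℝ) ≤ -0.1 by norm_num)
            (show (-0.1 : ℝ) < 0 by norm_num)).Dtmin - 2 * A) + 3 * (radialRowOneConst A ((bandBounds (show (-4 : ℝ) < -1.1 by norm_num) (show (-1.1 : ℝ) ≤ -0.1 by norm_num)
            (show (-0.1 : ℝ) < 0 by norm_num)).Dtmin - 2 * A) - 1 / ((bandBounds (show (-4 : ℝ) < -1.1 by norm_num) (show (-1.1 : ℝ) ≤ -0.1 by norm_num)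
            (show (-0.1 : ℝ) < 0 by norm_num)).Dtmin - 2 * A)) + 3 * uRowTwoConst A A₃ ((bandBounds (show (-4 : ℝ) < -1.1 by norm_num) (show (-1.1 : ℝ) ≤ -0.1 by norm_num)
            (show (-0.1 : ℝ) < 0 by norm_num)).Dtmin - 2 * A) + 1 / ((bandBounds (show (-4 : ℝ) < -1.1 by norm_num) (show (-1.1 : ℝ) ≤ -0.1 by norm_num)
            (show (-0.1 : ℝ) < 0 by norm_num)).Dtmin - 2 * A)) (msD A₃ A₄ 4))) *
          (r + π)) Λ (2 * msD A₃ A₄ 4) i)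
      r μ K (fun k q => Bf (k + q)) := by
  set B₀ := bandBounds (show (-4 : ℝ) < -1.1 by norm_num) (show (-1.1 : ℝ) ≤ -0.1 by norm_num) (show (-0.1 : ℝ) < 0 by norm_num) with hB₀def
  set dmin := B₀.Dtmin - 2 * A with hdmin
  set Lrad₂ := (uRowTwoConst A A₃ ((bandBounds (show (-4 : ℝ) < -1.1 by norm_num) (show (-1.1 : ℝ) ≤ -0.1 by norm_num) (show (-0.1 : ℝ) < 0 by norm_num)).Dtmin - 2 * A) + 1 / ((bandBounds (show (-4 : ℝ) < -1.1 by norm_num) (show (-1.1 : ℝ) ≤ -0.1 by norm_num) (show (-0.1 : ℝ) < 0 by norm_num)).Dtmin - 2 * A) + 2 * (radialRowOneConst A ((bandBounds (show (-4 : ℝ) < -1.1 by norm_num) (show (-1.1 : ℝ) ≤ -0.1 by norm_num) (show (-0.1 : ℝ) < 0 by norm_num)).Dtmin - 2 * A) - 1 / ((bandBounds (show (-4 : ℝ) < -1.1 by norm_num) (show (-1.1 : ℝ) ≤ -0.1 by norm_num) (show (-0.1 : ℝ) < 0 by norm_num)).Dtmin - 2 * A))) with hLrad₂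
  set Lrad₃ := (uRowThreeConst A A₃ A₄ ((bandBounds (show (-4 : ℝ) < -1.1 by norm_num) (show (-1.1 : ℝ) ≤ -0.1 by norm_num) (show (-0.1 : ℝ) < 0 by norm_num)).Dtmin - 2 * A) + 3 * (radialRowOneConst A ((bandBounds (show (-4 : ℝ) < -1.1 by norm_num) (show (-1.1 : ℝ) ≤ -0.1 by norm_num) (show (-0.1 : ℝ) < 0 by norm_num)).Dtmin - 2 * A) - 1 / ((bandBounds (show (-4 : ℝ) < -1.1 by norm_num) (show (-1.1 : ℝ) ≤ -0.1 by norm_num) (show (-0.1 : ℝ) < 0 by norm_num)).Dtmin - 2 * A)) + 3 * uRowTwoConst A A₃ ((bandBounds (show (-4 : ℝ) < -1.1 by norm_num) (show (-1.1 : ℝ) ≤ -0.1 by norm_num) (show (-0.1 : ℝ) < 0 by norm_num)).Dtmin - 2 * A) + 1 / ((bandBounds (show (-4 : ℝ) < -1.1 by norm_num) (show (-1.1 : ℝ) ≤ -0.1 by norm_num) (show (-0.1 : ℝ) < 0 by norm_num)).Dtmin - 2 * A)) with hLrad₃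
  have hrow₂ : ∀ ρ : ℝ, |ρ| < r → ∀ s : ℝ, ‖iteratedDeriv 2 (levelPoint μ K ρ) s - iteratedDeriv 2 (levelPoint μ K 0) s‖ ≤ Lrad₂ * |ρ| :=
    fun ρ hρ s => norm_iteratedDeriv_two_levelPoint_sub_le hA hA20 hd hr hlo hhi hA₃ hA₄ hρ s
  have hrow₃ : ∀ ρ : ℝ, |ρ| < r → ∀ s : ℝ, ‖iteratedDeriv 3 (levelPoint μ K ρ) s - iteratedDeriv 3 (levelPoint μ K 0) s‖ ≤ Lrad₃ * |ρ| :=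
    fun ρ hρ s => norm_iteratedDeriv_three_levelPoint_sub_le hA hA20 hd hr hlo hhi hA₃ hA₄ hρ s
  have hr2 : |r / 2| < r := by rw [abs_of_pos (by positivity)]; linarith
  have hL₂ : 0 ≤ Lrad₂ := by
    have h := (norm_nonneg _).trans (hrow₂ (r / 2) hr2 0)
    have hpos : 0 < |r / 2| := by rw [abs_of_pos (by positivity)]; positivity
    exact le_of_mul_le_mul_right (by rwa [zero_mul]) hpos
  set c := pairSumLowerConst r with hcdef
  set c₁ := c' * c with hc₁def
  set L := max (max (radialRowOneConst A dmin) (msD A₃ A₄ 2)) (max (max Lrad₂ (msD A₃ A₄ 3)) (max Lrad₃ (msD A₃ A₄ 4))) with hLdef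
  set x := L / c₁ with hxdef
  set y := L * (r + π) with hydef
  have hADt : 2 * A < B₀.Dtmin := by have := klCurveD_pos; linarith
  have hc0 : 0 < c := pairSumLowerConst_pos hr
  have hc₁0 : 0 < c₁ := mul_pos hc' hc0
  -- nonnegativity of the tables (they dominate norms)
  have h0r : |(0 : ℝ)| < r := by simpa using hr
  have hD2nn : 0 ≤ msD A₃ A₄ 2 := (norm_nonneg _).trans (norm_iteratedDeriv_levelPoint_le hA hA20 hd hlo hhi hA₃ hA₄ h0r (i := 2) (by norm_num) (by norm_num) 0)
  have hD3nn : 0 ≤ msD A₃ A₄ 3 := (norm_nonneg _).trans (norm_iteratedDeriv_levelPoint_le hA hA20 hd hlo hhi hA₃ hA₄ h0r (i := 3) (by norm_num) (by norm_num) 0)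
  have hD4nn : 0 ≤ msD A₃ A₄ 4 := (norm_nonneg _).trans (norm_iteratedDeriv_levelPoint_le hA hA20 hd hlo hhi hA₃ hA₄ h0r (i := 4) (by norm_num) (by norm_num) 0)
  have hL0 : 0 ≤ L := le_trans hL₂ ((le_max_left _ _).trans ((le_max_left _ _).trans (le_max_right _ _)))
  have hx0 : 0 ≤ x := div_nonneg hL0 hc₁0.le
  -- coefficient dominations by L
  have hL1a : radialRowOneConst A dmin ≤ L := (le_max_left _ _).trans (le_max_left _ _)
  have hL1b : msD A₃ A₄ 2 ≤ L := (le_max_right _ _).trans (le_max_left _ _)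
  have hL2a : Lrad₂ ≤ L := (le_max_left _ _).trans ((le_max_left _ _).trans (le_max_right _ _))
  have hL2b : msD A₃ A₄ 3 ≤ L := (le_max_right _ _).trans ((le_max_left _ _).trans (le_max_right _ _))
  have hL3a : Lrad₃ ≤ L := (le_max_left _ _).trans ((le_max_right _ _).trans (le_max_right _ _))
  have hL3b : msD A₃ A₄ 4 ≤ L := (le_max_right _ _).trans ((le_max_right _ _).trans (le_max_right _ _))
  refine ⟨fun i _ => integrableOn_const_box r _, fun θ ρ ϑ hρ => ?_⟩
  -- periodic reduction of the loop angle to [0, 2π)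
  set ϑ₀ := toIcoMod Real.two_pi_pos 0 ϑ with hϑ₀def
  have hϑ₀mem : ϑ₀ ∈ Ico 0 (0 + 2 * π) := toIcoMod_mem_Ico Real.two_pi_pos 0 ϑ
  have hϑ₀Icc : ϑ₀ ∈ Icc 0 (2 * π) := ⟨hϑ₀mem.1, by linarith [hϑ₀mem.2]⟩
  have hϑeq : ϑ₀ + toIcoDiv Real.two_pi_pos 0 ϑ • (2 * π) = ϑ := toIcoMod_add_toIcoDiv_zsmul Real.two_pi_pos 0 ϑ
  have hco : coMoving μ K (fun k q => Bf (k + q)) θ ρ (ϑ + θ) = coMoving μ K (fun k q => Bf (k + q)) θ ρ (ϑ₀ + θ) := by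
    rw [← hϑeq]; exact coMoving_angle_periodic μ K _ θ ρ ϑ₀ _
  rw [hco, coMoving_pairSum]
  have hS : ContDiff ℝ 4 (pairSumPath μ K ρ ϑ₀ θ) := contDiff_infty.1 (contDiff_pairSumPath B₀ hA hADt hr hlo hhi hρ ϑ₀ θ (m := ⊤)) 4
  refine ⟨hB.comp hS, fun i hi => ?_⟩
  -- the chart distance, the scale floor, and the pointwise majorants
  set δ := |ρ| + |ϑ₀ - π| with hδdef
  have hδ0 : 0 ≤ δ := by positivity
  set m := max (c₁ * δ) Λ with hmdef
  have hm0 : 0 < m := lt_max_of_lt_right hΛ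
  have hmΛ : Λ ≤ m := le_max_right _ _
  have hcomp : c * δ ≤ ‖pairSumPath μ K ρ ϑ₀ θ 0‖ := norm_pairSumPath_zero_ge hA hA20 hd hr hlo hhi hA₃ hA₄ hρ hϑ₀Icc θ
  have hm_le : m ≤ max (c' * ‖pairSumPath μ K ρ ϑ₀ θ 0‖) Λ :=
    max_le_max (by rw [hc₁def, mul_assoc]; exact mul_le_mul_of_nonneg_left hcomp hc'.le) le_rfl
  set M : ℕ → ℝ := fun k => if k = 0 then Cb0 else Cb k / m with hMdef
  set D : ℕ → ℝ := fun i => ‖iteratedDeriv i (pairSumPath μ K ρ ϑ₀ θ) 0‖ with hDdef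
  have hMk : ∀ k, 1 ≤ k → k ≤ 4 → ‖iteratedFDeriv ℝ k Bf (pairSumPath μ K ρ ϑ₀ θ 0)‖ ≤ M k := by
    intro k hk1 hk4
    have hk0 : k ≠ 0 := by omega
    simp only [hMdef, hk0, if_false]
    refine (hBk _ k hk1 hk4).trans ?_
    rw [div_eq_mul_inv]
    exact mul_le_mul_of_nonneg_left (inv_anti₀ hm0 hm_le) (hCb k)
  have hM0 : ‖Bf (pairSumPath μ K ρ ϑ₀ θ 0)‖ ≤ M 0 := by simp only [hMdef, if_true]; exact hB0 _
  have hDi : ∀ i, 1 ≤ i → i ≤ 4 → ‖iteratedDeriv i (pairSumPath μ K ρ ϑ₀ θ) 0‖ ≤ D i := fun i _ _ => le_rfl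
  have hbell := norm_iteratedDeriv_comp_le_bell4_complex hB hS hMk hM0 hDi hi
  -- rigidity: D i ≤ L δ ≤ x m for i ≤ 3
  have hLδ : L * δ ≤ x * m := by
    have h := mul_max_le (δ := δ) (Λ := Λ) hc₁0 hL0
    rwa [← hxdef, ← hmdef] at h
  have hDδ : ∀ i, 1 ≤ i → i ≤ 3 → D i ≤ L * δ := by
    intro i hi1 hi3
    interval_cases i
    · refine (norm_deriv_pairSumPath_le_rigid hA hA20 hd hr hlo hhi hA₃ hA₄ hρ ϑ₀ θ).trans ?_
      rw [hδdef, mul_add]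
      exact add_le_add (mul_le_mul_of_nonneg_right hL1a (abs_nonneg _)) (mul_le_mul_of_nonneg_right hL1b (abs_nonneg _))
    · refine (norm_iteratedDeriv_pairSumPath_le_rigid hA hA20 hd hr hlo hhi hA₃ hA₄ hρ (i := 2) (by norm_num) (hrow₂ ρ hρ) ϑ₀ θ).trans ?_
      rw [hδdef, mul_add]
      exact add_le_add (mul_le_mul_of_nonneg_right hL2a (abs_nonneg _)) (mul_le_mul_of_nonneg_right hL2b (abs_nonneg _))
    · refine (norm_iteratedDeriv_pairSumPath_le_rigid hA hA20 hd hr hlo hhi hA₃ hA₄ hρ (i := 3) (by norm_num) (hrow₃ ρ hρ) ϑ₀ θ).trans ?_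
      rw [hδdef, mul_add]
      exact add_le_add (mul_le_mul_of_nonneg_right hL3a (abs_nonneg _)) (mul_le_mul_of_nonneg_right hL3b (abs_nonneg _))
  have hDs : ∀ i, 1 ≤ i → i ≤ 3 → D i ≤ x * m := fun i hi1 hi3 => (hDδ i hi1 hi3).trans hLδ
  have hDs0 : ∀ i, 1 ≤ i → i ≤ 4 → 0 ≤ D i := fun i _ _ => norm_nonneg _
  have hMb0 : ∀ k, 1 ≤ k → k ≤ 4 → 0 ≤ M k := fun k hk1 hk4 => (norm_nonneg _).trans (hMk k hk1 hk4)
  have hMb : ∀ k, 1 ≤ k → k ≤ 4 → M k ≤ Cb k / m := by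
    intro k hk1 _; have hk0 : k ≠ 0 := by omega
    simp only [hMdef, hk0, if_false, le_refl]
  -- the path jets are also bounded by the constant `y = L·(r + π)` (`δ ≤ r + π`)
  have hδle : δ ≤ r + π := by
    have h1 : |ϑ₀ - π| ≤ π := abs_sub_le_iff.2 ⟨by linarith [hϑ₀mem.2], by linarith [hϑ₀mem.1]⟩
    rw [hδdef]; linarith [hρ.le]
  have hDy : ∀ i, 1 ≤ i → i ≤ 3 → D i ≤ y := fun i hi1 hi3 =>
    (hDδ i hi1 hi3).trans (by rw [hydef]; exact mul_le_mul_of_nonneg_left hδle hL0)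
  obtain ⟨r1, r2, r3, r4⟩ := bell4_le_of_rigid_one hm0 hMb0 hMb hDs0 hDs hDy
  -- the order-4 non-rigid monomial: M 1 · D 4 ≤ (Cb/Λ)·(2 msD₄)
  have hD4 : D 4 ≤ 2 * msD A₃ A₄ 4 := norm_iteratedDeriv_pairSumPath_le hA hA20 hd hr hlo hhi hA₃ hA₄ θ ρ ϑ₀ hρ 4 (by norm_num) le_rfl
  have hM1 : M 1 ≤ Cb 1 / Λ := by
    have h1 : (1 : ℕ) ≠ 0 := one_ne_zero
    simp only [hMdef, h1, if_false]
    exact div_le_div_of_nonneg_left (hCb 1) hΛ hmΛ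
  have hM1D4 : M 1 * D 4 ≤ Cb 1 / Λ * (2 * msD A₃ A₄ 4) :=
    mul_le_mul hM1 hD4 (norm_nonneg _) (div_nonneg (hCb 1) hΛ.le)
  refine hbell.trans ?_
  interval_cases i
  · simp only [bell4, ppJetDominatorOne, hMdef, if_true]; exact le_rfl
  · simp only [ppJetDominatorOne]; linarith
  · simp only [ppJetDominatorOne]; linarith
  · simp only [ppJetDominatorOne]; linarith
  · simp only [ppJetDominatorOne]; linarith


/-- **(L3) FOR THE PARTICLE–HOLE EXCHANGE CLASS, ASSEMBLED** (twin of `coMovingJetsL1_pairSum_of_inversePower`): same hypotheses on `B` and the radial rows;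
`CoMovingJetsL1 4 (fun i _ => ppJetDominator Cb Cb0 x Λ (2·msD A₃ A₄ 4) i) r μ K (fun k q => B (k − q))`. [cite: BenfattoGiulianiMastropietro2006, §2.4 (2.36)–(2.41)] -/
theorem coMovingJetsL1_pairDiff_of_inversePowerOne {Bf : Momentum → ℂ} (hB : ContDiff ℝ 4 Bf) {Cb : ℕ → ℝ} {Cb0 c' Λ : ℝ} (hCb : ∀ k, 0 ≤ Cb k)
    (hc' : 0 < c') (hΛ : 0 < Λ)
    (hBk : ∀ p : Momentum, ∀ k, 1 ≤ k → k ≤ 4 → ‖iteratedFDeriv ℝ k Bf p‖ ≤ Cb k * (max (c' * ‖p‖) Λ)⁻¹)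
    (hB0 : ∀ p : Momentum, ‖Bf p‖ ≤ Cb0) :
    CoMovingJetsL1 4
      (fun i _ => ppJetDominatorOne Cb Cb0
        (max (max (radialRowOneConst A ((bandBounds (show (-4 : ℝ) < -1.1 by norm_num) (show (-1.1 : ℝ) ≤ -0.1 by norm_num)
            (show (-0.1 : ℝ) < 0 by norm_num)).Dtmin - 2 * A)) (msD A₃ A₄ 2)) (max (max (uRowTwoConst A A₃ ((bandBounds (show (-4 : ℝ) < -1.1 by norm_num) (show (-1.1 : ℝ) ≤ -0.1 by norm_num)
            (show (-0.1 : ℝ) < 0 by norm_num)).Dtmin - 2 * A) + 1 / ((bandBounds (show (-4 : ℝ) < -1.1 by norm_num) (show (-1.1 : ℝ) ≤ -0.1 by norm_num)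
            (show (-0.1 : ℝ) < 0 by norm_num)).Dtmin - 2 * A) + 2 * (radialRowOneConst A ((bandBounds (show (-4 : ℝ) < -1.1 by norm_num) (show (-1.1 : ℝ) ≤ -0.1 by norm_num)
            (show (-0.1 : ℝ) < 0 by norm_num)).Dtmin - 2 * A) - 1 / ((bandBounds (show (-4 : ℝ) < -1.1 by norm_num) (show (-1.1 : ℝ) ≤ -0.1 by norm_num)
            (show (-0.1 : ℝ) < 0 by norm_num)).Dtmin - 2 * A))) (msD A₃ A₄ 3)) (max (uRowThreeConst A A₃ A₄ ((bandBounds (show (-4 : ℝ) < -1.1 by norm_num) (show (-1.1 : ℝ) ≤ -0.1 by norm_num)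
            (show (-0.1 : ℝ) < 0 by norm_num)).Dtmin - 2 * A) + 3 * (radialRowOneConst A ((bandBounds (show (-4 : ℝ) < -1.1 by norm_num) (show (-1.1 : ℝ) ≤ -0.1 by norm_num)
            (show (-0.1 : ℝ) < 0 by norm_num)).Dtmin - 2 * A) - 1 / ((bandBounds (show (-4 : ℝ) < -1.1 by norm_num) (show (-1.1 : ℝ) ≤ -0.1 by norm_num)
            (show (-0.1 : ℝ) < 0 by norm_num)).Dtmin - 2 * A)) + 3 * uRowTwoConst A A₃ ((bandBounds (show (-4 : ℝ) < -1.1 by norm_num) (show (-1.1 : ℝ) ≤ -0.1 by norm_num)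
            (show (-0.1 : ℝ) < 0 by norm_num)).Dtmin - 2 * A) + 1 / ((bandBounds (show (-4 : ℝ) < -1.1 by norm_num) (show (-1.1 : ℝ) ≤ -0.1 by norm_num)
            (show (-0.1 : ℝ) < 0 by norm_num)).Dtmin - 2 * A)) (msD A₃ A₄ 4))) /
          (c' * pairSumLowerConst r))
        (max (max (radialRowOneConst A ((bandBounds (show (-4 : ℝ) < -1.1 by norm_num) (show (-1.1 : ℝ) ≤ -0.1 by norm_num)
            (show (-0.1 : ℝ) < 0 by norm_num)).Dtmin - 2 * A)) (msD A₃ A₄ 2)) (max (max (uRowTwoConst A A₃ ((bandBounds (show (-4 : ℝ) < -1.1 by norm_num) (show (-1.1 : ℝ) ≤ -0.1 by norm_num)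
            (show (-0.1 : ℝ) < 0 by norm_num)).Dtmin - 2 * A) + 1 / ((bandBounds (show (-4 : ℝ) < -1.1 by norm_num) (show (-1.1 : ℝ) ≤ -0.1 by norm_num)
            (show (-0.1 : ℝ) < 0 by norm_num)).Dtmin - 2 * A) + 2 * (radialRowOneConst A ((bandBounds (show (-4 : ℝ) < -1.1 by norm_num) (show (-1.1 : ℝ) ≤ -0.1 by norm_num)
            (show (-0.1 : ℝ) < 0 by norm_num)).Dtmin - 2 * A) - 1 / ((bandBounds (show (-4 : ℝ) < -1.1 by norm_num) (show (-1.1 : ℝ) ≤ -0.1 by norm_num)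
            (show (-0.1 : ℝ) < 0 by norm_num)).Dtmin - 2 * A))) (msD A₃ A₄ 3)) (max (uRowThreeConst A A₃ A₄ ((bandBounds (show (-4 : ℝ) < -1.1 by norm_num) (show (-1.1 : ℝ) ≤ -0.1 by norm_num)
            (show (-0.1 : ℝ) < 0 by norm_num)).Dtmin - 2 * A) + 3 * (radialRowOneConst A ((bandBounds (show (-4 : ℝ) < -1.1 by norm_num) (show (-1.1 : ℝ) ≤ -0.1 by norm_num)
            (show (-0.1 : ℝ) < 0 by norm_num)).Dtmin - 2 * A) - 1 / ((bandBounds (show (-4 : ℝ) < -1.1 by norm_num) (show (-1.1 : ℝ) ≤ -0.1 by norm_num)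
            (show (-0.1 : ℝ) < 0 by norm_num)).Dtmin - 2 * A)) + 3 * uRowTwoConst A A₃ ((bandBounds (show (-4 : ℝ) < -1.1 by norm_num) (show (-1.1 : ℝ) ≤ -0.1 by norm_num)
            (show (-0.1 : ℝ) < 0 by norm_num)).Dtmin - 2 * A) + 1 / ((bandBounds (show (-4 : ℝ) < -1.1 by norm_num) (show (-1.1 : ℝ) ≤ -0.1 by norm_num)
            (show (-0.1 : ℝ) < 0 by norm_num)).Dtmin - 2 * A)) (msD A₃ A₄ 4))) *
          (r + π)) Λ (2 * msD A₃ A₄ 4) i)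
      r μ K (fun k q => Bf (k - q)) := by
  set B₀ := bandBounds (show (-4 : ℝ) < -1.1 by norm_num) (show (-1.1 : ℝ) ≤ -0.1 by norm_num) (show (-0.1 : ℝ) < 0 by norm_num) with hB₀def
  set dmin := B₀.Dtmin - 2 * A with hdmin
  set Lrad₂ := (uRowTwoConst A A₃ ((bandBounds (show (-4 : ℝ) < -1.1 by norm_num) (show (-1.1 : ℝ) ≤ -0.1 by norm_num) (show (-0.1 : ℝ) < 0 by norm_num)).Dtmin - 2 * A) + 1 / ((bandBounds (show (-4 : ℝ) < -1.1 by norm_num) (show (-1.1 : ℝ) ≤ -0.1 by norm_num) (show (-0.1 : ℝ) < 0 by norm_num)).Dtmin - 2 * A) + 2 * (radialRowOneConst A ((bandBounds (show (-4 : ℝ) < -1.1 by norm_num) (show (-1.1 : ℝ) ≤ -0.1 by norm_num) (show (-0.1 : ℝ) < 0 by norm_num)).Dtmin - 2 * A) - 1 / ((bandBounds (show (-4 : ℝ) < -1.1 by norm_num) (show (-1.1 : ℝ) ≤ -0.1 by norm_num) (show (-0.1 : ℝ) < 0 by norm_num)).Dtmin - 2 * A))) with hLrad₂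
  set Lrad₃ := (uRowThreeConst A A₃ A₄ ((bandBounds (show (-4 : ℝ) < -1.1 by norm_num) (show (-1.1 : ℝ) ≤ -0.1 by norm_num) (show (-0.1 : ℝ) < 0 by norm_num)).Dtmin - 2 * A) + 3 * (radialRowOneConst A ((bandBounds (show (-4 : ℝ) < -1.1 by norm_num) (show (-1.1 : ℝ) ≤ -0.1 by norm_num) (show (-0.1 : ℝ) < 0 by norm_num)).Dtmin - 2 * A) - 1 / ((bandBounds (show (-4 : ℝ) < -1.1 by norm_num) (show (-1.1 : ℝ) ≤ -0.1 by norm_num) (show (-0.1 : ℝ) < 0 by norm_num)).Dtmin - 2 * A)) + 3 * uRowTwoConst A A₃ ((bandBounds (show (-4 : ℝ) < -1.1 by norm_num) (show (-1.1 : ℝ) ≤ -0.1 by norm_num) (show (-0.1 : ℝ) < 0 by norm_num)).Dtmin - 2 * A) + 1 / ((bandBounds (show (-4 : ℝ) < -1.1 by norm_num) (show (-1.1 : ℝ) ≤ -0.1 by norm_num) (show (-0.1 : ℝ) < 0 by norm_num)).Dtmin - 2 * A)) with hLrad₃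
  have hrow₂ : ∀ ρ : ℝ, |ρ| < r → ∀ s : ℝ, ‖iteratedDeriv 2 (levelPoint μ K ρ) s - iteratedDeriv 2 (levelPoint μ K 0) s‖ ≤ Lrad₂ * |ρ| :=
    fun ρ hρ s => norm_iteratedDeriv_two_levelPoint_sub_le hA hA20 hd hr hlo hhi hA₃ hA₄ hρ s
  have hrow₃ : ∀ ρ : ℝ, |ρ| < r → ∀ s : ℝ, ‖iteratedDeriv 3 (levelPoint μ K ρ) s - iteratedDeriv 3 (levelPoint μ K 0) s‖ ≤ Lrad₃ * |ρ| :=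
    fun ρ hρ s => norm_iteratedDeriv_three_levelPoint_sub_le hA hA20 hd hr hlo hhi hA₃ hA₄ hρ s
  have hr2 : |r / 2| < r := by rw [abs_of_pos (by positivity)]; linarith
  have hL₂ : 0 ≤ Lrad₂ := by
    have h := (norm_nonneg _).trans (hrow₂ (r / 2) hr2 0)
    have hpos : 0 < |r / 2| := by rw [abs_of_pos (by positivity)]; positivity
    exact le_of_mul_le_mul_right (by rwa [zero_mul]) hpos
  set c := pairSumLowerConst r with hcdef
  set c₁ := c' * c with hc₁def
  set L := max (max (radialRowOneConst A dmin) (msD A₃ A₄ 2)) (max (max Lrad₂ (msD A₃ A₄ 3)) (max Lrad₃ (msD A₃ A₄ 4))) with hLdef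
  set x := L / c₁ with hxdef
  set y := L * (r + π) with hydef
  have hADt : 2 * A < B₀.Dtmin := by have := klCurveD_pos; linarith
  have hc0 : 0 < c := pairSumLowerConst_pos hr
  have hc₁0 : 0 < c₁ := mul_pos hc' hc0
  have h0r : |(0 : ℝ)| < r := by simpa using hr
  have hL0 : 0 ≤ L := le_trans hL₂ ((le_max_left _ _).trans ((le_max_left _ _).trans (le_max_right _ _)))
  have hL1a : radialRowOneConst A dmin ≤ L := (le_max_left _ _).trans (le_max_left _ _)
  have hL1b : msD A₃ A₄ 2 ≤ L := (le_max_right _ _).trans (le_max_left _ _)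
  have hL2a : Lrad₂ ≤ L := (le_max_left _ _).trans ((le_max_left _ _).trans (le_max_right _ _))
  have hL2b : msD A₃ A₄ 3 ≤ L := (le_max_right _ _).trans ((le_max_left _ _).trans (le_max_right _ _))
  have hL3a : Lrad₃ ≤ L := (le_max_left _ _).trans ((le_max_right _ _).trans (le_max_right _ _))
  have hL3b : msD A₃ A₄ 4 ≤ L := (le_max_right _ _).trans ((le_max_right _ _).trans (le_max_right _ _))
  have hD2nn : 0 ≤ msD A₃ A₄ 2 := (norm_nonneg _).trans (norm_iteratedDeriv_levelPoint_le hA hA20 hd hlo hhi hA₃ hA₄ h0r (i := 2) (by norm_num) (by norm_num) 0)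
  have hD3nn : 0 ≤ msD A₃ A₄ 3 := (norm_nonneg _).trans (norm_iteratedDeriv_levelPoint_le hA hA20 hd hlo hhi hA₃ hA₄ h0r (i := 3) (by norm_num) (by norm_num) 0)
  have hD4nn : 0 ≤ msD A₃ A₄ 4 := (norm_nonneg _).trans (norm_iteratedDeriv_levelPoint_le hA hA20 hd hlo hhi hA₃ hA₄ h0r (i := 4) (by norm_num) (by norm_num) 0)
  refine ⟨fun i _ => integrableOn_const_box r _, fun θ ρ ϑ hρ => ?_⟩
  -- periodic reduction of the loop angle to [0, 2π)
  set ϑ₀ := toIcoMod Real.two_pi_pos 0 ϑ with hϑ₀def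
  have hϑ₀mem : ϑ₀ ∈ Ico 0 (0 + 2 * π) := toIcoMod_mem_Ico Real.two_pi_pos 0 ϑ
  have hϑ₀Icc : ϑ₀ ∈ Icc 0 (2 * π) := ⟨hϑ₀mem.1, by linarith [hϑ₀mem.2]⟩
  have hϑeq : ϑ₀ + toIcoDiv Real.two_pi_pos 0 ϑ • (2 * π) = ϑ := toIcoMod_add_toIcoDiv_zsmul Real.two_pi_pos 0 ϑ
  have hco : coMoving μ K (fun k q => Bf (k - q)) θ ρ (ϑ + θ) = coMoving μ K (fun k q => Bf (k - q)) θ ρ (ϑ₀ + θ) := by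
    rw [← hϑeq]; exact coMoving_angle_periodic μ K _ θ ρ ϑ₀ _
  rw [hco, coMoving_pairDiff]
  have hS : ContDiff ℝ 4 (pairDiffPath μ K ρ ϑ₀ θ) := contDiff_infty.1 (contDiff_pairDiffPath B₀ hA hADt hr hlo hhi hρ ϑ₀ θ (m := ⊤)) 4
  refine ⟨hB.comp hS, fun i hi => ?_⟩
  -- chart distance to the forward configuration, scale floor, pointwise majorants
  set dang := min |ϑ₀| |ϑ₀ - 2 * π| with hdangdef
  have hdang0 : 0 ≤ dang := le_min (abs_nonneg _) (abs_nonneg _)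
  set δ := |ρ| + dang with hδdef
  have hδ0 : 0 ≤ δ := by positivity
  set m := max (c₁ * δ) Λ with hmdef
  have hm0 : 0 < m := lt_max_of_lt_right hΛ
  have hmΛ : Λ ≤ m := le_max_right _ _
  have hcomp : c * δ ≤ ‖pairDiffPath μ K ρ ϑ₀ θ 0‖ := norm_pairDiffPath_zero_ge hA hA20 hd hr hlo hhi hA₃ hA₄ hρ hϑ₀Icc θ
  have hm_le : m ≤ max (c' * ‖pairDiffPath μ K ρ ϑ₀ θ 0‖) Λ :=
    max_le_max (by rw [hc₁def, mul_assoc]; exact mul_le_mul_of_nonneg_left hcomp hc'.le) le_rfl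
  set M : ℕ → ℝ := fun k => if k = 0 then Cb0 else Cb k / m with hMdef
  set D : ℕ → ℝ := fun i => ‖iteratedDeriv i (pairDiffPath μ K ρ ϑ₀ θ) 0‖ with hDdef
  have hMk : ∀ k, 1 ≤ k → k ≤ 4 → ‖iteratedFDeriv ℝ k Bf (pairDiffPath μ K ρ ϑ₀ θ 0)‖ ≤ M k := by
    intro k hk1 hk4
    have hk0 : k ≠ 0 := by omega
    simp only [hMdef, hk0, if_false]
    refine (hBk _ k hk1 hk4).trans ?_
    rw [div_eq_mul_inv]
    exact mul_le_mul_of_nonneg_left (inv_anti₀ hm0 hm_le) (hCb k)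
  have hM0 : ‖Bf (pairDiffPath μ K ρ ϑ₀ θ 0)‖ ≤ M 0 := by simp only [hMdef, if_true]; exact hB0 _
  have hDi : ∀ i, 1 ≤ i → i ≤ 4 → ‖iteratedDeriv i (pairDiffPath μ K ρ ϑ₀ θ) 0‖ ≤ D i := fun i _ _ => le_rfl
  have hbell := norm_iteratedDeriv_comp_le_bell4_complex hB hS hMk hM0 hDi hi
  -- rigidity at the forward configuration, in the `min` form
  have hrig : ∀ i, i ≤ 3 → ∀ Lr : ℝ,
      (∀ s : ℝ, ‖iteratedDeriv i (levelPoint μ K ρ) s - iteratedDeriv i (levelPoint μ K 0) s‖ ≤ Lr) → D i ≤ Lr + msD A₃ A₄ (i + 1) * dang := by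
    intro i hi3 Lr hLr
    have h1 := norm_iteratedDeriv_pairDiffPath_le_rigid hA hA20 hd hr hlo hhi hA₃ hA₄ hρ hi3 hLr ϑ₀ θ
    have h2 := norm_iteratedDeriv_pairDiffPath_le_rigid' hA hA20 hd hr hlo hhi hA₃ hA₄ hρ hi3 hLr ϑ₀ θ
    show ‖iteratedDeriv i (pairDiffPath μ K ρ ϑ₀ θ) 0‖ ≤ Lr + msD A₃ A₄ (i + 1) * dang
    rcases le_total |ϑ₀| |ϑ₀ - 2 * π| with h | h
    · rw [hdangdef, min_eq_left h]; exact h1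
    · rw [hdangdef, min_eq_right h]; exact h2
  have hLδ : L * δ ≤ x * m := by
    have h := mul_max_le (δ := δ) (Λ := Λ) hc₁0 hL0
    rwa [← hxdef, ← hmdef] at h
  have hDδ : ∀ i, 1 ≤ i → i ≤ 3 → D i ≤ L * δ := by
    intro i hi1 hi3
    interval_cases i
    · refine (hrig 1 (by norm_num) _ (fun s => norm_iteratedDeriv_one_levelPoint_sub_le hA hd hr hlo hhi hρ s)).trans ?_
      rw [hδdef, mul_add]
      exact add_le_add (mul_le_mul_of_nonneg_right hL1a (abs_nonneg _)) (mul_le_mul_of_nonneg_right hL1b hdang0)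
    · refine (hrig 2 (by norm_num) _ (hrow₂ ρ hρ)).trans ?_
      rw [hδdef, mul_add]
      exact add_le_add (mul_le_mul_of_nonneg_right hL2a (abs_nonneg _)) (mul_le_mul_of_nonneg_right hL2b hdang0)
    · refine (hrig 3 (by norm_num) _ (hrow₃ ρ hρ)).trans ?_
      rw [hδdef, mul_add]
      exact add_le_add (mul_le_mul_of_nonneg_right hL3a (abs_nonneg _)) (mul_le_mul_of_nonneg_right hL3b hdang0)
  have hDs : ∀ i, 1 ≤ i → i ≤ 3 → D i ≤ x * m := fun i hi1 hi3 => (hDδ i hi1 hi3).trans hLδ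
  have hDs0 : ∀ i, 1 ≤ i → i ≤ 4 → 0 ≤ D i := fun i _ _ => norm_nonneg _
  have hMb0 : ∀ k, 1 ≤ k → k ≤ 4 → 0 ≤ M k := fun k hk1 hk4 => (norm_nonneg _).trans (hMk k hk1 hk4)
  have hMb : ∀ k, 1 ≤ k → k ≤ 4 → M k ≤ Cb k / m := by
    intro k hk1 _; have hk0 : k ≠ 0 := by omega
    simp only [hMdef, hk0, if_false, le_refl]
  -- the path jets are also bounded by the constant `y = L·(r + π)` (`δ ≤ r + π`)
  have hδle : δ ≤ r + π := by
    have h1 : dang ≤ π := by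
      rcases le_or_gt ϑ₀ π with h | h
      · exact (min_le_left _ _).trans (by rw [abs_of_nonneg hϑ₀mem.1]; exact h)
      · refine (min_le_right _ _).trans ?_
        rw [abs_sub_comm, abs_of_nonneg (by linarith [hϑ₀mem.2])]; linarith
    rw [hδdef]; linarith [hρ.le]
  have hDy : ∀ i, 1 ≤ i → i ≤ 3 → D i ≤ y := fun i hi1 hi3 =>
    (hDδ i hi1 hi3).trans (by rw [hydef]; exact mul_le_mul_of_nonneg_left hδle hL0)
  obtain ⟨r1, r2, r3, r4⟩ := bell4_le_of_rigid_one hm0 hMb0 hMb hDs0 hDs hDy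
  have hD4 : D 4 ≤ 2 * msD A₃ A₄ 4 := norm_iteratedDeriv_pairDiffPath_le hA hA20 hd hr hlo hhi hA₃ hA₄ θ ρ ϑ₀ hρ 4 (by norm_num) le_rfl
  have hM1 : M 1 ≤ Cb 1 / Λ := by
    have h1 : (1 : ℕ) ≠ 0 := one_ne_zero
    simp only [hMdef, h1, if_false]
    exact div_le_div_of_nonneg_left (hCb 1) hΛ hmΛ
  have hM1D4 : M 1 * D 4 ≤ Cb 1 / Λ * (2 * msD A₃ A₄ 4) :=
    mul_le_mul hM1 hD4 (norm_nonneg _) (div_nonneg (hCb 1) hΛ.le)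
  refine hbell.trans ?_
  interval_cases i
  · simp only [bell4, ppJetDominatorOne, hMdef, if_true]; exact le_rfl
  · simp only [ppJetDominatorOne]; linarith
  · simp only [ppJetDominatorOne]; linarith
  · simp only [ppJetDominatorOne]; linarith
  · simp only [ppJetDominatorOne]; linarith

end Sizes

end Summit.HubbardSuperconductivity.HubbardSuperconductivity.Theorems.C4a

end
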